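import Literature.Dynamics.ConleyIndex.IsolatingBlock
import Literature.Dynamics.ConleyIndex.PolyfacialSet
import HarnessLib

/-!
# Regular polyfacial sets are isolating blocks

Topic `Literature/Dynamics/ConleyIndex`; continues `PolyfacialSet.lean` (`faceSet h`,
`IsRegularPolyfacial φ h d`, forward/backward behaviour of the faces along orbits and solutions)
and `IsolatingBlock.lean` (`strictEgressSet`, `strictIngressSet`, `bounceOffSet`,
`IsIsolatingBlock`).  For a regular polyfacial set `B = {x | ∀ i, 0 ≤ h i x}` (finitely many
faces, first-order transversality `h i x = 0 → d i x ≠ 0` on `B`) of a continuous semiflow, a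
boundary point `x` is classified by the signs of `d i x` on its ACTIVE faces `{i | h i x = 0}`:

* all negative ⇒ strict egress (`mem_strictEgressSet`), all positive ⇒ strict ingress
  (`mem_strictIngressSet`), both signs present ⇒ bounce-off (`mem_bounceOffSet`); hence
  `∂B = Bᵉ ∪ Bⁱ ∪ Bᵇ` (`frontier_eq`), `Bⁱ = {all active d i > 0}` (`strictIngressSet_eq`) and
  `B⁻ = Bᵉ ∪ Bᵇ = {x ∈ ∂B | ∃ i, h i x = 0 ∧ d i x < 0}` (`blockExitSet_eq`);
* under LOCAL BACKWARD SOLVABILITY at boundary points (every `x ∈ ∂B` has a solution on some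
  `[-δ, 1]`, `δ > 0`, through it — automatic for ODE flows, and exactly what rules out the
  degenerate overlap `Bᵉ ∩ Bᵇ` of [HaleMagalhaesOliva2002, App. A, p. 243, Note]) also
  `Bᵉ = {all active d i < 0}`, `Bᵇ = {both signs}` and
  **`IsRegularPolyfacial.isIsolatingBlock : IsIsolatingBlock φ (faceSet h)`** — Ważewski's
  regular polyfacial sets are isolating blocks [Wazewski1947; Hartman2002, Ch. X §3, Lemma 3.1
  (egress points of `(u, v)`-subsets); HaleMagalhaesOliva2002, App. A, p. 244; Conley1978, Ch. II].

All statements are theorems (no new definitions).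
-/

open Set Filter
open scoped Topology

namespace Literature.Dynamics.ConleyIndex

namespace IsRegularPolyfacial

variable {X : Type*} [TopologicalSpace X] {ι : Type*} [Finite ι] {φ : ℝ → X → X}
  {h d : ι → X → ℝ} {x : X}

/-- **All active faces strictly exiting ⇒ strict egress point.** [folklore] -/
theorem mem_strictEgressSet (hF : IsRegularPolyfacial φ h d) (hx : x ∈ frontier (faceSet h))
    (hneg : ∀ i, h i x = 0 → d i x < 0) : x ∈ strictEgressSet φ (faceSet h) := by
  obtain ⟨hxB, i₀, hi₀⟩ := exists_face_eq_zero_of_mem_frontier hF.continuous_face hx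
  refine ⟨hx, fun δ₁ δ₂ hδ₁ hδ₂ σ hσ hσ0 => ⟨?_, fun hδ₁' => ?_⟩⟩
  · obtain ⟨ε, hε, hout⟩ := hF.forall_not_mem_of_deriv_neg hi₀ (hneg i₀ hi₀)
    refine ⟨min ε δ₂, ⟨lt_min hε hδ₂, min_le_right _ _⟩, fun t ht => ?_⟩
    rw [hσ.eq_orbit ⟨by linarith, hδ₂.le⟩ ht.1.le ⟨by linarith [ht.1], ht.2.trans (min_le_right _ _)⟩,
      hσ0]
    exact hout t ⟨ht.1, ht.2.trans (min_le_left _ _)⟩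
  · exact hF.forall_mem_interior_before_of_deriv_neg hσ hδ₁' hδ₂.le hσ0 hxB hneg

/-- **All active faces strictly entering ⇒ strict ingress point.** [folklore] -/
theorem mem_strictIngressSet (hF : IsRegularPolyfacial φ h d) (hx : x ∈ frontier (faceSet h))
    (hpos : ∀ i, h i x = 0 → 0 < d i x) : x ∈ strictIngressSet φ (faceSet h) := by
  obtain ⟨hxB, i₀, hi₀⟩ := exists_face_eq_zero_of_mem_frontier hF.continuous_face hx
  refine ⟨hx, fun δ₁ δ₂ hδ₁ hδ₂ σ hσ hσ0 => ⟨?_, fun hδ₁' => ?_⟩⟩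
  · obtain ⟨ε, hε, hin⟩ := hF.forall_mem_interior_of_deriv_pos hxB hpos
    refine ⟨min ε δ₂, ⟨lt_min hε hδ₂, min_le_right _ _⟩, fun t ht => ?_⟩
    rw [hσ.eq_orbit ⟨by linarith, hδ₂.le⟩ ht.1.le ⟨by linarith [ht.1], ht.2.trans (min_le_right _ _)⟩,
      hσ0]
    exact hin t ⟨ht.1, ht.2.trans (min_le_left _ _)⟩
  · exact hF.forall_not_mem_before_of_deriv_pos hσ hδ₁' hδ₂.le hσ0 hi₀ (hpos i₀ hi₀)

omit [Finite ι] in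
/-- **Active faces of both signs ⇒ bounce-off point.** [folklore] -/
theorem mem_bounceOffSet (hF : IsRegularPolyfacial φ h d) (hx : x ∈ frontier (faceSet h))
    {i j : ι} (hi : h i x = 0) (hdi : d i x < 0) (hj : h j x = 0) (hdj : 0 < d j x) :
    x ∈ bounceOffSet φ (faceSet h) := by
  refine ⟨hx, fun δ₁ δ₂ hδ₁ hδ₂ σ hσ hσ0 => ⟨?_, fun hδ₁' => ?_⟩⟩
  · obtain ⟨ε, hε, hout⟩ := hF.forall_not_mem_of_deriv_neg hi hdi
    refine ⟨min ε δ₂, ⟨lt_min hε hδ₂, min_le_right _ _⟩, fun t ht => ?_⟩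
    rw [hσ.eq_orbit ⟨by linarith, hδ₂.le⟩ ht.1.le ⟨by linarith [ht.1], ht.2.trans (min_le_right _ _)⟩,
      hσ0]
    exact hout t ⟨ht.1, ht.2.trans (min_le_left _ _)⟩
  · exact hF.forall_not_mem_before_of_deriv_pos hσ hδ₁' hδ₂.le hσ0 hj hdj

/-- **`∂B = Bᵉ ∪ Bⁱ ∪ Bᵇ`** for a regular polyfacial set: by transversality the active faces
of a boundary point are all exiting, all entering, or of both kinds. [folklore] -/
theorem frontier_eq (hF : IsRegularPolyfacial φ h d) :
    frontier (faceSet h) = strictEgressSet φ (faceSet h) ∪ strictIngressSet φ (faceSet h) ∪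
      bounceOffSet φ (faceSet h) := by
  refine Subset.antisymm (fun x hx => ?_) (union_subset (union_subset
    strictEgressSet_subset_frontier strictIngressSet_subset_frontier) bounceOffSet_subset_frontier)
  obtain ⟨hxB, -⟩ := exists_face_eq_zero_of_mem_frontier hF.continuous_face hx
  by_cases hn : ∃ i, h i x = 0 ∧ d i x < 0
  · by_cases hp : ∃ j, h j x = 0 ∧ 0 < d j x
    · obtain ⟨i, hi, hdi⟩ := hn
      obtain ⟨j, hj, hdj⟩ := hp
      exact Or.inr (hF.mem_bounceOffSet hx hi hdi hj hdj)
    · push Not at hp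
      exact Or.inl (Or.inl (hF.mem_strictEgressSet hx fun i hi =>
        (hp i hi).lt_of_ne (hF.deriv_ne_zero x hxB i hi)))
  · push Not at hn
    exact Or.inl (Or.inr (hF.mem_strictIngressSet hx fun i hi =>
      (hn i hi).lt_of_ne (hF.deriv_ne_zero x hxB i hi).symm))

/-- A strict ingress, strict egress or bounce-off point whose forward orbit EXITS has an active
exiting face. [folklore] -/
theorem exists_deriv_neg_of_forall_not_mem (hF : IsRegularPolyfacial φ h d)
    (hxB : x ∈ faceSet h) {ε : ℝ} (hε : 0 < ε) (hout : ∀ t ∈ Ioc 0 ε, φ t x ∈ (faceSet h)ᶜ) :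
    ∃ i, h i x = 0 ∧ d i x < 0 := by
  by_contra hne
  push Not at hne
  have hpos : ∀ i, h i x = 0 → 0 < d i x := fun i hi =>
    (hne i hi).lt_of_ne (hF.deriv_ne_zero x hxB i hi).symm
  obtain ⟨ε', hε', hin⟩ := hF.forall_mem_interior_of_deriv_pos hxB hpos
  have hm : min ε ε' ∈ Ioc 0 ε := ⟨lt_min hε hε', min_le_left _ _⟩
  have hm' : min ε ε' ∈ Ioc 0 ε' := ⟨lt_min hε hε', min_le_right _ _⟩
  exact hout _ hm (interior_subset (hin _ hm'))

/-- **`Bⁱ` = the boundary points all of whose active faces are entering.** [folklore] -/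
theorem strictIngressSet_eq (hF : IsRegularPolyfacial φ h d) :
    strictIngressSet φ (faceSet h) =
      {x | x ∈ frontier (faceSet h) ∧ ∀ i, h i x = 0 → 0 < d i x} := by
  refine Subset.antisymm (fun x hx => ?_) fun x hx => hF.mem_strictIngressSet hx.1 hx.2
  have hfr : x ∈ frontier (faceSet h) := strictIngressSet_subset_frontier hx
  obtain ⟨hxB, -⟩ := exists_face_eq_zero_of_mem_frontier hF.continuous_face hfr
  refine ⟨hfr, fun i hi => ?_⟩
  by_contra hle
  have hdi : d i x < 0 := (not_lt.1 hle).lt_of_ne (hF.deriv_ne_zero x hxB i hi)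
  obtain ⟨ε, hε, hout⟩ := hF.forall_not_mem_of_deriv_neg hi hdi
  obtain ⟨ε', hε', hin⟩ := hF.isSemiflow.eventually_mem_of_mem_boundaryBehaviourSet hx
  have hm : min ε ε' ∈ Ioc 0 ε := ⟨lt_min hε hε', min_le_left _ _⟩
  have hm' : min ε ε' ∈ Ioc 0 ε' := ⟨lt_min hε hε', min_le_right _ _⟩
  exact hout _ hm (interior_subset (hin _ hm'))

/-- **`B⁻ = Bᵉ ∪ Bᵇ` = the boundary points with an active exiting face.** [folklore] -/
theorem blockExitSet_eq (hF : IsRegularPolyfacial φ h d) :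
    blockExitSet φ (faceSet h) = {x | x ∈ frontier (faceSet h) ∧ ∃ i, h i x = 0 ∧ d i x < 0} := by
  refine Subset.antisymm (fun x hx => ?_) ?_
  · have hfr : x ∈ frontier (faceSet h) := blockExitSet_subset_frontier hx
    obtain ⟨hxB, -⟩ := exists_face_eq_zero_of_mem_frontier hF.continuous_face hfr
    have hout : ∃ ε : ℝ, 0 < ε ∧ ∀ t ∈ Ioc 0 ε, φ t x ∈ (faceSet h)ᶜ := by
      rcases hx with he | hb
      · exact hF.isSemiflow.eventually_mem_of_mem_boundaryBehaviourSet he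
      · exact hF.isSemiflow.eventually_mem_of_mem_boundaryBehaviourSet hb
    obtain ⟨ε, hε, hout⟩ := hout
    exact ⟨hfr, hF.exists_deriv_neg_of_forall_not_mem hxB hε hout⟩
  · rintro x ⟨hfr, i, hi, hdi⟩
    by_cases hp : ∃ j, h j x = 0 ∧ 0 < d j x
    · obtain ⟨j, hj, hdj⟩ := hp
      exact Or.inr (hF.mem_bounceOffSet hfr hi hdi hj hdj)
    · push Not at hp
      obtain ⟨hxB, -⟩ := exists_face_eq_zero_of_mem_frontier hF.continuous_face hfr
      exact Or.inl (hF.mem_strictEgressSet hfr fun k hk =>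
        (hp k hk).lt_of_ne (hF.deriv_ne_zero x hxB k hk))

/-! ### With local backward solvability at the boundary -/

section Backward

variable (hback : ∀ x ∈ frontier (faceSet h), ∃ δ > 0, ∃ σ : ℝ → X,
  IsSolutionOn φ σ (Icc (-δ) 1) ∧ σ 0 = x)
include hback

/-- **`Bᵉ` = the boundary points all of whose active faces are exiting**, when boundary points
have backward solutions. [folklore] -/
theorem strictEgressSet_eq (hF : IsRegularPolyfacial φ h d) :
    strictEgressSet φ (faceSet h) =
      {x | x ∈ frontier (faceSet h) ∧ ∀ i, h i x = 0 → d i x < 0} := by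
  refine Subset.antisymm (fun x hx => ?_) fun x hx => hF.mem_strictEgressSet hx.1 hx.2
  have hfr : x ∈ frontier (faceSet h) := strictEgressSet_subset_frontier hx
  obtain ⟨hxB, -⟩ := exists_face_eq_zero_of_mem_frontier hF.continuous_face hfr
  refine ⟨hfr, fun i hi => ?_⟩
  by_contra hle
  have hdi : 0 < d i x := (not_lt.1 hle).lt_of_ne (hF.deriv_ne_zero x hxB i hi).symm
  obtain ⟨δ, hδ, σ, hσ, hσ0⟩ := hback x hfr
  -- backward clause of strict egress vs. the exiting face `i` run backwards
  obtain ⟨ε₁, hε₁, hin⟩ := (hx.2 δ 1 hδ.le one_pos σ hσ hσ0).2 hδ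
  obtain ⟨ε, hε, hout⟩ := hF.forall_not_mem_before_of_deriv_pos hσ hδ zero_le_one hσ0 hi hdi
  have ht : -(min ε₁ ε / 2) ∈ Ico (-ε₁) 0 :=
    ⟨by linarith [min_le_left ε₁ ε, lt_min hε₁.1 hε.1], by simp [lt_min hε₁.1 hε.1]⟩
  have ht' : -(min ε₁ ε / 2) ∈ Ico (-ε) 0 :=
    ⟨by linarith [min_le_right ε₁ ε, lt_min hε₁.1 hε.1], by simp [lt_min hε₁.1 hε.1]⟩
  exact hout _ ht' (interior_subset (hin _ ht))

/-- **`Bᵇ` = the boundary points with active faces of both kinds**, when boundary points have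
backward solutions. [folklore] -/
theorem bounceOffSet_eq (hF : IsRegularPolyfacial φ h d) :
    bounceOffSet φ (faceSet h) = {x | x ∈ frontier (faceSet h) ∧
      (∃ i, h i x = 0 ∧ d i x < 0) ∧ ∃ j, h j x = 0 ∧ 0 < d j x} := by
  refine Subset.antisymm (fun x hx => ?_) ?_
  · have hfr : x ∈ frontier (faceSet h) := bounceOffSet_subset_frontier hx
    obtain ⟨hxB, -⟩ := exists_face_eq_zero_of_mem_frontier hF.continuous_face hfr
    obtain ⟨ε, hε, hout⟩ := hF.isSemiflow.eventually_mem_of_mem_boundaryBehaviourSet hx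
    refine ⟨hfr, hF.exists_deriv_neg_of_forall_not_mem hxB hε hout, ?_⟩
    by_contra hne
    push Not at hne
    have hneg : ∀ i, h i x = 0 → d i x < 0 := fun i hi =>
      (hne i hi).lt_of_ne (hF.deriv_ne_zero x hxB i hi)
    obtain ⟨δ, hδ, σ, hσ, hσ0⟩ := hback x hfr
    obtain ⟨ε₁, hε₁, hout'⟩ := (hx.2 δ 1 hδ.le one_pos σ hσ hσ0).2 hδ
    obtain ⟨ε', hε', hin⟩ :=
      hF.forall_mem_interior_before_of_deriv_neg hσ hδ zero_le_one hσ0 hxB hneg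
    have ht : -(min ε₁ ε' / 2) ∈ Ico (-ε₁) 0 :=
      ⟨by linarith [min_le_left ε₁ ε', lt_min hε₁.1 hε'.1], by simp [lt_min hε₁.1 hε'.1]⟩
    have ht' : -(min ε₁ ε' / 2) ∈ Ico (-ε') 0 :=
      ⟨by linarith [min_le_right ε₁ ε', lt_min hε₁.1 hε'.1], by simp [lt_min hε₁.1 hε'.1]⟩
    exact hout' _ ht (interior_subset (hin _ ht'))
  · rintro x ⟨hfr, ⟨i, hi, hdi⟩, j, hj, hdj⟩
    exact hF.mem_bounceOffSet hfr hi hdi hj hdj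

/-- **Ważewski's regular polyfacial sets are isolating blocks** (first-order transversality,
finitely many faces, continuous semiflow with backward solutions through boundary points):
`∂B = Bᵉ ∪ Bⁱ ∪ Bᵇ`, and `Bᵉ = ∂B ∩ {∀ i, h i ≠ 0 ∨ d i < 0}`,
`Bⁱ = ∂B ∩ {∀ i, h i ≠ 0 ∨ d i > 0}` are open in `∂B`.  (Closed-set / semiflow form of
Hartman's Lemma 3.1 on the egress points of `(u, v)`-subsets, organised as Rybakowski's
Def. A.0.4.) [cite: Hartman2002, Ch. X §3, Lemma 3.1, p. 280] -/
theorem isIsolatingBlock (hF : IsRegularPolyfacial φ h d) : IsIsolatingBlock φ (faceSet h) where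
  isClosed := isClosed_faceSet hF.continuous_face
  frontier_eq := hF.frontier_eq
  isOpen_strictEgressSet := by
    refine ⟨{y | ∀ i, h i y ≠ 0 ∨ d i y < 0}, ?_, ?_⟩
    · have : {y : X | ∀ i, h i y ≠ 0 ∨ d i y < 0} = ⋂ i, ({y | h i y ≠ 0} ∪ {y | d i y < 0}) := by
        ext y; simp
      rw [this]
      exact isOpen_iInter_of_finite fun i =>
        (isOpen_ne_fun (hF.continuous_face i) continuous_const).union
          (isOpen_lt (hF.continuous_deriv i) continuous_const)
    · rw [hF.strictEgressSet_eq hback]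
      ext y
      simp only [mem_inter_iff, mem_setOf_eq]
      constructor
      · rintro ⟨hU, hfr⟩
        exact ⟨hfr, fun i hi => (hU i).resolve_left (by simpa using hi)⟩
      · rintro ⟨hfr, hneg⟩
        refine ⟨fun i => ?_, hfr⟩
        by_cases hi : h i y = 0
        · exact Or.inr (hneg i hi)
        · exact Or.inl hi
  isOpen_strictIngressSet := by
    refine ⟨{y | ∀ i, h i y ≠ 0 ∨ 0 < d i y}, ?_, ?_⟩
    · have : {y : X | ∀ i, h i y ≠ 0 ∨ 0 < d i y} = ⋂ i, ({y | h i y ≠ 0} ∪ {y | 0 < d i y}) := by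
        ext y; simp
      rw [this]
      exact isOpen_iInter_of_finite fun i =>
        (isOpen_ne_fun (hF.continuous_face i) continuous_const).union
          (isOpen_lt continuous_const (hF.continuous_deriv i))
    · rw [hF.strictIngressSet_eq]
      ext y
      simp only [mem_inter_iff, mem_setOf_eq]
      constructor
      · rintro ⟨hU, hfr⟩
        exact ⟨hfr, fun i hi => (hU i).resolve_left (by simpa using hi)⟩
      · rintro ⟨hfr, hpos⟩
        refine ⟨fun i => ?_, hfr⟩
        by_cases hi : h i y = 0
        · exact Or.inr (hpos i hi)
        · exact Or.inl hi

/-- **Ważewski's principle for a regular polyfacial block**: if `B⁻ = {x ∈ ∂B | ∃ i, h i x = 0 ∧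
d i x < 0}` is not a strong deformation retract of `B = faceSet h`, some forward orbit stays in
`B`. [cite: HaleMagalhaesOliva2002, App. A, p. 243] -/
theorem exists_forall_mem (hF : IsRegularPolyfacial φ h d)
    (hr : ¬ AlgebraicTopology.Homotopy.IsStrongDeformationRetractOf
      {x | x ∈ frontier (faceSet h) ∧ ∃ i, h i x = 0 ∧ d i x < 0} (faceSet h)) :
    ∃ x ∈ faceSet h, ∀ t : ℝ, 0 ≤ t → φ t x ∈ faceSet h := by
  rw [← hF.blockExitSet_eq] at hr
  exact (hF.isIsolatingBlock hback).exists_forall_mem hF.isSemiflow hr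

end Backward

end IsRegularPolyfacial

end Literature.Dynamics.ConleyIndex
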